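import Mathlib
import Summits.MatrixMultiplication.MatrixMultiplication.Theorems.SnSubsetDichotomyPolynomialSlackPermMGF

/-!
# A Bernstein inequality for randomly permuted sums, II: sorted budget and the tail bound

Continuation of `…PolynomialSlackPermMGF` (the order-dependent exponential-moment bound `mgf_perm_le`):
sorting the rows by decreasing norm bounds the budget by `8(1 + log n)·n⁻¹Σa²` (`mgf_perm_le_sorted`), a
Chernoff step in counting form (`card_filter_le_of_mgf`) and the union of the two tails give
`card_permutedSum_tail_le`:
`#{π ∈ S_n : t ≤ |Σ_i a i (π i) - n⁻¹Σ_{ij} a i j|} ≤ 2·n!·exp(-t²/(32(1 + log n)·n⁻¹Σ a² + 8mt))`,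
a crude-constant, extra-`log n` but SELF-CONTAINED substitute for the named fact
`Literature.Probability.Moments.BercuDelyonRio2015_permutedSum` in the level-one programme.
-/

namespace Summit.MatrixMultiplication.MatrixMultiplication.Theorems.PolynomialSlack

open scoped BigOperators

-- `Summit.<Summit>.<Problem>` is the tree's mandated summit-side namespace (CONVENTIONS §2); for
-- this single-conjunct summit the two coincide, so each declaration silences `dupNamespace`.
set_option linter.dupNamespace false

/-- The harmonic-type sum `Σ_{k<n} 1/((n-k)(k+1)) ≤ 2(1 + log n)/(n+1)` (partial fractions and
`H_n ≤ 1 + log n`). [folklore] -/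
theorem sum_inv_mul_le (n : ℕ) :
    ∑ k : Fin n, 1 / (((n : ℝ) - k) * ((k : ℝ) + 1)) ≤ 2 * (1 + Real.log n) / ((n : ℝ) + 1) := by
  have hH : ∑ k : Fin n, 1 / ((k : ℝ) + 1) ≤ 1 + Real.log n := by
    have h := harmonic_le_one_add_log n
    have e : ((harmonic n : ℚ) : ℝ) = ∑ k : Fin n, 1 / ((k : ℝ) + 1) := by
      unfold harmonic
      rw [Fin.sum_univ_eq_sum_range (fun k => 1 / ((k : ℝ) + 1)) n]
      push_cast
      exact Finset.sum_congr rfl fun i _ => by rw [one_div]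
    rwa [e] at h
  have hrev : ∑ k : Fin n, 1 / ((n : ℝ) - k) = ∑ k : Fin n, 1 / ((k : ℝ) + 1) := by
    rw [← Equiv.sum_comp Fin.revPerm (fun k : Fin n => 1 / ((k : ℝ) + 1))]
    refine Finset.sum_congr rfl fun k _ => ?_
    have hk : (k : ℕ) + 1 ≤ n := k.isLt
    simp only [Fin.revPerm_apply, Fin.val_rev]
    rw [Nat.cast_sub hk]
    push_cast
    ring
  have hpf : ∀ k : Fin n, 1 / (((n : ℝ) - k) * ((k : ℝ) + 1)) = (1 / ((k : ℝ) + 1) + 1 / ((n : ℝ) - k)) / ((n : ℝ) + 1) := by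
    intro k
    have hk : (k : ℝ) + 1 ≤ n := by exact_mod_cast k.isLt
    have h1 : (n : ℝ) - k ≠ 0 := by linarith
    have h2 : (k : ℝ) + 1 ≠ 0 := by linarith [k.val.cast_nonneg (α := ℝ)]
    field_simp
    ring
  rw [Finset.sum_congr rfl fun k _ => hpf k, ← Finset.sum_div, Finset.sum_add_distrib, hrev]
  have hn1 : (0 : ℝ) < (n : ℝ) + 1 := by positivity
  exact div_le_div_of_nonneg_right (by linarith [hH]) hn1.le

/-- **Sorted budget.** For rows sorted by decreasing norm the budget is at most `8(1 + log n)·n⁻¹Σ_{ij} a²`;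
for a general array this holds after relabelling the rows, which changes neither the permuted-sum
statistic nor its mean: `Σ_π exp(λ(Z - μ)) ≤ n!·exp(λ²·8(1 + log n)·n⁻¹·Σ_{ij} a i j²)` for
`0 ≤ λ ≤ 1/(4m)`. [folklore] -/
theorem mgf_perm_le_sorted (n : ℕ) (m : ℝ) (hm : 0 ≤ m) (a : Fin n → Fin n → ℝ) (ha : ∀ i j, |a i j| ≤ m)
    (l : ℝ) (hl : 0 ≤ l) (hlm : l * (4 * m) ≤ 1) :
    ∑ π : Equiv.Perm (Fin n), Real.exp (l * (∑ i, a i (π i) - (∑ i, ∑ j, a i j) / n)) ≤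
      (n.factorial : ℝ) * Real.exp (l ^ 2 * (8 * (1 + Real.log n) * (∑ i, ∑ j, a i j ^ 2) / n)) := by
  rcases Nat.eq_zero_or_pos n with rfl | hn
  · simp
  have hnR : (0 : ℝ) < n := by exact_mod_cast hn
  -- sort the rows by decreasing norm
  set N : Fin n → ℝ := fun i => ∑ j, a i j ^ 2 with hN
  set σ : Equiv.Perm (Fin n) := Tuple.sort (fun i => -N i) with hσ
  have hanti : ∀ i k : Fin n, i ≤ k → N (σ k) ≤ N (σ i) := by
    intro i k hik
    have := Tuple.monotone_sort (fun i => -N i) hik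
    simp only [Function.comp_apply] at this
    linarith
  set b : Fin n → Fin n → ℝ := fun k j => a (σ k) j with hb
  have hbm : ∀ k j, |b k j| ≤ m := fun k j => ha _ _
  have hmgf := mgf_perm_le n m hm b hbm l hl hlm
  -- the statistic and the mean are unchanged
  have hmean : (∑ i, ∑ j, b i j) = ∑ i, ∑ j, a i j := Equiv.sum_comp σ (fun i => ∑ j, a i j)
  have hstat : ∑ π : Equiv.Perm (Fin n), Real.exp (l * (∑ i, b i (π i) - (∑ i, ∑ j, b i j) / n)) =
      ∑ π : Equiv.Perm (Fin n), Real.exp (l * (∑ i, a i (π i) - (∑ i, ∑ j, a i j) / n)) := by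
    rw [hmean]
    refine Fintype.sum_equiv (Equiv.mulRight σ⁻¹) _ _ fun π => ?_
    congr 3
    simp only [hb, Equiv.coe_mulRight]
    rw [← Equiv.sum_comp σ (fun i => a i ((π * σ⁻¹) i))]
    simp [Equiv.Perm.mul_apply]
  rw [← hstat]
  refine hmgf.trans (mul_le_mul_of_nonneg_left (Real.exp_le_exp.mpr (mul_le_mul_of_nonneg_left ?_ (sq_nonneg l))) (Nat.cast_nonneg _))
  -- the budget of the sorted array
  have hNb : ∀ k, ∑ j, b k j ^ 2 = N (σ k) := fun k => rfl
  simp_rw [hNb]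
  have hTot : ∑ k, N (σ k) = ∑ i, ∑ j, a i j ^ 2 := Equiv.sum_comp σ N
  have hN0 : ∀ i, 0 ≤ N i := fun i => Finset.sum_nonneg fun _ _ => sq_nonneg _
  -- prefix bound: `(k+1)·N(σ k) ≤ T`
  have hpre : ∀ k : Fin n, ((k : ℝ) + 1) * N (σ k) ≤ ∑ i, ∑ j, a i j ^ 2 := by
    intro k
    have h1 : (Finset.Iic k).card • N (σ k) ≤ ∑ i ∈ Finset.Iic k, N (σ i) :=
      Finset.card_nsmul_le_sum _ _ _ fun i hi => hanti i k (Finset.mem_Iic.mp hi)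
    rw [Fin.card_Iic, nsmul_eq_mul] at h1
    push_cast at h1
    have h2 : ∑ i ∈ Finset.Iic k, N (σ i) ≤ ∑ i, N (σ i) :=
      Finset.sum_le_sum_of_subset_of_nonneg (Finset.subset_univ _) fun i _ _ => hN0 _
    rw [hTot] at h2
    linarith
  -- termwise
  have hterm : ∀ k : Fin n, (4 / ((n : ℝ) - k) - 2 / (n : ℝ)) * N (σ k) ≤
      4 * (∑ i, ∑ j, a i j ^ 2) * (1 / (((n : ℝ) - k) * ((k : ℝ) + 1))) := by
    intro k
    have hk : (k : ℝ) + 1 ≤ n := by exact_mod_cast k.isLt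
    have hk0 : (0 : ℝ) ≤ k := k.val.cast_nonneg
    have hnk : 0 < (n : ℝ) - k := by linarith
    have h1 : (4 / ((n : ℝ) - k) - 2 / (n : ℝ)) * N (σ k) ≤ 4 / ((n : ℝ) - k) * N (σ k) := by
      have : 0 ≤ 2 / (n : ℝ) * N (σ k) := by positivity
      nlinarith
    have h2 : 4 / ((n : ℝ) - k) * N (σ k) = 4 * (((k : ℝ) + 1) * N (σ k)) * (1 / (((n : ℝ) - k) * ((k : ℝ) + 1))) := by
      field_simp
    rw [h2] at h1
    refine h1.trans (mul_le_mul_of_nonneg_right (mul_le_mul_of_nonneg_left (hpre k) (by norm_num)) (by positivity))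
  calc ∑ k : Fin n, (4 / ((n : ℝ) - k) - 2 / (n : ℝ)) * N (σ k)
      ≤ ∑ k : Fin n, 4 * (∑ i, ∑ j, a i j ^ 2) * (1 / (((n : ℝ) - k) * ((k : ℝ) + 1))) := Finset.sum_le_sum fun k _ => hterm k
    _ = 4 * (∑ i, ∑ j, a i j ^ 2) * ∑ k : Fin n, 1 / (((n : ℝ) - k) * ((k : ℝ) + 1)) := by rw [← Finset.mul_sum]
    _ ≤ 4 * (∑ i, ∑ j, a i j ^ 2) * (2 * (1 + Real.log n) / ((n : ℝ) + 1)) :=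
        mul_le_mul_of_nonneg_left (sum_inv_mul_le n) (by positivity)
    _ ≤ 8 * (1 + Real.log n) * (∑ i, ∑ j, a i j ^ 2) / n := by
        have hT0 : 0 ≤ ∑ i, ∑ j, a i j ^ 2 := Finset.sum_nonneg fun i _ => hN0 i
        have hlog : 0 ≤ 1 + Real.log n := by
          have := Real.log_nonneg (show (1 : ℝ) ≤ n by exact_mod_cast hn); linarith
        rw [le_div_iff₀ hnR]
        have : 4 * (∑ i, ∑ j, a i j ^ 2) * (2 * (1 + Real.log n) / ((n : ℝ) + 1)) * n =
            8 * (1 + Real.log n) * (∑ i, ∑ j, a i j ^ 2) * (n / ((n : ℝ) + 1)) := by ring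
        rw [this]
        have hfrac : (n : ℝ) / ((n : ℝ) + 1) ≤ 1 := by rw [div_le_one (by positivity)]; linarith
        calc 8 * (1 + Real.log n) * (∑ i, ∑ j, a i j ^ 2) * (n / ((n : ℝ) + 1))
            ≤ 8 * (1 + Real.log n) * (∑ i, ∑ j, a i j ^ 2) * 1 := mul_le_mul_of_nonneg_left hfrac (by positivity)
          _ = _ := by ring

/-- **Chernoff step** (counting form): if `Σ_x exp(λ f x) ≤ |ι|·exp(λ²V)` for all `0 ≤ λ ≤ 1/(4m)`
(`V, m ≥ 0`), then `#{x : t ≤ f x} ≤ |ι|·exp(-t²/(4V + 8mt))` for `t > 0`. [folklore] -/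
theorem card_filter_le_of_mgf {ι : Type*} [Fintype ι] (f : ι → ℝ) (V m t : ℝ) (hV : 0 ≤ V) (hm : 0 ≤ m)
    (ht : 0 < t) (hmgf : ∀ l : ℝ, 0 ≤ l → l * (4 * m) ≤ 1 → ∑ x, Real.exp (l * f x) ≤ Fintype.card ι * Real.exp (l ^ 2 * V)) :
    ((Finset.univ.filter fun x => t ≤ f x).card : ℝ) ≤ Fintype.card ι * Real.exp (-(t ^ 2 / (4 * V + 8 * m * t))) := by
  classical
  set A := Finset.univ.filter fun x => t ≤ f x with hA
  -- the basic Chernoff estimate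
  have hbasic : ∀ l : ℝ, 0 ≤ l → l * (4 * m) ≤ 1 → (A.card : ℝ) ≤ Fintype.card ι * Real.exp (l ^ 2 * V - l * t) := by
    intro l hl hlm
    have h1 : (A.card : ℝ) * Real.exp (l * t) ≤ ∑ x, Real.exp (l * f x) := by
      calc (A.card : ℝ) * Real.exp (l * t) = ∑ x ∈ A, Real.exp (l * t) := by
            rw [Finset.sum_const, nsmul_eq_mul]
        _ ≤ ∑ x ∈ A, Real.exp (l * f x) := Finset.sum_le_sum fun x hx =>
            Real.exp_le_exp.mpr (mul_le_mul_of_nonneg_left (Finset.mem_filter.mp hx).2 hl)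
        _ ≤ ∑ x, Real.exp (l * f x) :=
            Finset.sum_le_sum_of_subset_of_nonneg (Finset.subset_univ _) fun x _ _ => (Real.exp_pos _).le
    have h2 := h1.trans (hmgf l hl hlm)
    rw [sub_eq_add_neg, Real.exp_add, ← mul_assoc]
    have h3 : Real.exp (l * t) * Real.exp (-(l * t)) = 1 := by rw [← Real.exp_add, add_neg_cancel, Real.exp_zero]
    calc (A.card : ℝ) = (A.card : ℝ) * Real.exp (l * t) * Real.exp (-(l * t)) := by rw [mul_assoc, h3, mul_one]
      _ ≤ Fintype.card ι * Real.exp (l ^ 2 * V) * Real.exp (-(l * t)) :=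
          mul_le_mul_of_nonneg_right h2 (Real.exp_pos _).le
  have hcardle : (A.card : ℝ) ≤ Fintype.card ι := by exact_mod_cast Finset.card_le_univ A
  -- choice of `λ`
  by_cases hden : 4 * V + 8 * m * t = 0
  · rw [hden, div_zero, neg_zero, Real.exp_zero, mul_one]; exact hcardle
  have hden0 : 0 < 4 * V + 8 * m * t := by
    have : 0 ≤ 4 * V + 8 * m * t := by positivity
    exact lt_of_le_of_ne this (Ne.symm hden)
  by_cases hcase : 2 * m * t ≤ V
  · -- `λ = t/(2V)`
    have hV0 : 0 < V := by
      rcases eq_or_lt_of_le hV with h | h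
      · exfalso; apply hden; rw [← h] at hcase ⊢; nlinarith
      · exact h
    have hl0 : 0 ≤ t / (2 * V) := by positivity
    have hl1 : t / (2 * V) * (4 * m) ≤ 1 := by
      rw [div_mul_eq_mul_div, div_le_one (by positivity)]; nlinarith
    refine (hbasic _ hl0 hl1).trans (mul_le_mul_of_nonneg_left (Real.exp_le_exp.mpr ?_) (Nat.cast_nonneg _))
    have e : (t / (2 * V)) ^ 2 * V - t / (2 * V) * t = -(t ^ 2 / (4 * V)) := by field_simp; ring
    rw [e, neg_le_neg_iff]
    exact div_le_div_of_nonneg_left (sq_nonneg t) (by positivity) (by nlinarith)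
  · -- `λ = 1/(4m)`
    rw [not_le] at hcase
    have hm0 : 0 < m := by
      rcases eq_or_lt_of_le hm with h | h
      · rw [← h] at hcase; linarith
      · exact h
    have hl0 : 0 ≤ 1 / (4 * m) := by positivity
    have hl1 : 1 / (4 * m) * (4 * m) ≤ 1 := by rw [one_div_mul_cancel (by positivity)]
    refine (hbasic _ hl0 hl1).trans (mul_le_mul_of_nonneg_left (Real.exp_le_exp.mpr ?_) (Nat.cast_nonneg _))
    have e1 : (1 / (4 * m)) ^ 2 * V - 1 / (4 * m) * t ≤ -(t / (8 * m)) := by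
      have e : (1 / (4 * m)) ^ 2 * V - 1 / (4 * m) * t = (V - 4 * m * t) / (16 * m ^ 2) := by
        field_simp; ring
      have e' : -(t / (8 * m)) * (16 * m ^ 2) = -(2 * m * t) := by field_simp; ring
      rw [e, div_le_iff₀ (by positivity), e']
      linarith
    refine e1.trans ?_
    rw [neg_le_neg_iff, div_le_div_iff₀ hden0 (by positivity)]
    nlinarith [mul_nonneg hV ht.le]

/-- **Bernstein-type tail bound for randomly permuted sums** (crude constants; self-contained): for
`a : Fin n → Fin n → ℝ` with `|a i j| ≤ m` and `t > 0`,
`#{π ∈ S_n : t ≤ |Σ_i a i (π i) - n⁻¹Σ_{ij} a i j|} ≤ 2·n!·exp(-t²/(32(1 + log n)·n⁻¹Σ_{ij} a i j² + 8mt))`.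
Compare `Literature.Probability.Moments.BercuDelyonRio2015_permutedSum` (proxy `θ·n⁻¹Σa²`, no `log n`).
[folklore] -/
theorem card_permutedSum_tail_le {n : ℕ} (m : ℝ) (a : Fin n → Fin n → ℝ) (ha : ∀ i j, |a i j| ≤ m)
    (t : ℝ) (ht : 0 < t) :
    ((Finset.univ.filter fun π : Equiv.Perm (Fin n) =>
        t ≤ |∑ i, a i (π i) - (∑ i, ∑ j, a i j) / n|).card : ℝ) ≤
      2 * (n.factorial : ℝ) *
        Real.exp (-(t ^ 2 / (32 * (1 + Real.log n) * (∑ i, ∑ j, a i j ^ 2) / n + 8 * m * t))) := by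
  classical
  rcases Nat.eq_zero_or_pos n with rfl | hn
  · have : (Finset.univ.filter fun π : Equiv.Perm (Fin 0) =>
        t ≤ |∑ i, a i (π i) - (∑ i, ∑ j, a i j) / (0 : ℕ)|) = ∅ := by
      ext π; simp [not_le.mpr ht]
    rw [this]; simp; positivity
  haveI : Nonempty (Fin n) := ⟨⟨0, hn⟩⟩
  have hm : 0 ≤ m := (abs_nonneg _).trans (ha (Classical.arbitrary _) (Classical.arbitrary _))
  have hnR : (0 : ℝ) < n := by exact_mod_cast hn
  have hlog : 0 ≤ 1 + Real.log n := by
    have := Real.log_nonneg (show (1 : ℝ) ≤ n by exact_mod_cast hn); linarith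
  set V : ℝ := 8 * (1 + Real.log n) * (∑ i, ∑ j, a i j ^ 2) / n with hV
  have hV0 : 0 ≤ V := by
    have : 0 ≤ ∑ i, ∑ j, a i j ^ 2 := Finset.sum_nonneg fun _ _ => Finset.sum_nonneg fun _ _ => sq_nonneg _
    positivity
  have hcard : (Fintype.card (Equiv.Perm (Fin n)) : ℝ) = n.factorial := by
    rw [Fintype.card_perm, Fintype.card_fin]
  set f : Equiv.Perm (Fin n) → ℝ := fun π => ∑ i, a i (π i) - (∑ i, ∑ j, a i j) / n with hf
  -- upper tail
  have hup : ((Finset.univ.filter fun π => t ≤ f π).card : ℝ) ≤ n.factorial * Real.exp (-(t ^ 2 / (4 * V + 8 * m * t))) := by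
    rw [← hcard]
    refine card_filter_le_of_mgf f V m t hV0 hm ht fun l hl hlm => ?_
    rw [hcard]
    exact mgf_perm_le_sorted n m hm a ha l hl hlm
  -- lower tail, via `-a`
  have hlow : ((Finset.univ.filter fun π => t ≤ -f π).card : ℝ) ≤ n.factorial * Real.exp (-(t ^ 2 / (4 * V + 8 * m * t))) := by
    rw [← hcard]
    refine card_filter_le_of_mgf (fun π => -f π) V m t hV0 hm ht fun l hl hlm => ?_
    rw [hcard]
    have h := mgf_perm_le_sorted n m hm (fun i j => -a i j) (fun i j => by rw [abs_neg]; exact ha i j) l hl hlm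
    have e1 : ∀ π : Equiv.Perm (Fin n), (∑ i, -a i (π i) - (∑ i, ∑ j, -a i j) / n) = -f π := by
      intro π; simp only [hf, Finset.sum_neg_distrib]; ring
    have e2 : (∑ i, ∑ j, (-a i j) ^ 2) = ∑ i, ∑ j, a i j ^ 2 := by simp
    simp_rw [e1, e2] at h
    exact h
  -- union bound
  have hsub : (Finset.univ.filter fun π => t ≤ |f π|) ⊆
      (Finset.univ.filter fun π => t ≤ f π) ∪ (Finset.univ.filter fun π => t ≤ -f π) := by
    intro π hπ
    rw [Finset.mem_filter] at hπ
    rw [Finset.mem_union, Finset.mem_filter, Finset.mem_filter]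
    rcases le_or_gt 0 (f π) with h | h
    · left; exact ⟨Finset.mem_univ _, by rw [abs_of_nonneg h] at hπ; exact hπ.2⟩
    · right; exact ⟨Finset.mem_univ _, by rw [abs_of_neg h] at hπ; exact hπ.2⟩
  have hden : 4 * V + 8 * m * t = 32 * (1 + Real.log n) * (∑ i, ∑ j, a i j ^ 2) / n + 8 * m * t := by
    rw [hV]; ring
  calc ((Finset.univ.filter fun π => t ≤ |f π|).card : ℝ)
      ≤ (((Finset.univ.filter fun π => t ≤ f π) ∪ (Finset.univ.filter fun π => t ≤ -f π)).card : ℝ) := by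
        exact_mod_cast Finset.card_le_card hsub
    _ ≤ ((Finset.univ.filter fun π => t ≤ f π).card : ℝ) + ((Finset.univ.filter fun π => t ≤ -f π).card : ℝ) := by
        exact_mod_cast Finset.card_union_le _ _
    _ ≤ n.factorial * Real.exp (-(t ^ 2 / (4 * V + 8 * m * t))) + n.factorial * Real.exp (-(t ^ 2 / (4 * V + 8 * m * t))) :=
        add_le_add hup hlow
    _ = 2 * (n.factorial : ℝ) * Real.exp (-(t ^ 2 / (32 * (1 + Real.log n) * (∑ i, ∑ j, a i j ^ 2) / n + 8 * m * t))) := by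
        rw [hden]; ring

end Summit.MatrixMultiplication.MatrixMultiplication.Theorems.PolynomialSlack
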